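import Summits.ResolutionOfSingularities.ResolutionOfSingularities.Theorems.PurelyInseparableDim4JointForestDepthTwoKit
import Summits.ResolutionOfSingularities.ResolutionOfSingularities.Theorems.PurelyInseparableDim4JointTwoChartComputations
import Summits.ResolutionOfSingularities.ResolutionOfSingularities.Theorems.PurelyInseparableDim4JointForestInstance
import Summits.ResolutionOfSingularities.ResolutionOfSingularities.Theorems.PurelyInseparableDim4PointQuadric
import HarnessLib

/-!
# Purely inseparable four-folds, `p = 2`: `z² + x₁³x₂ + x₁²x₃x₄` is order-reduced by blowing up the 3-fold `V(z, x₁)` and then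
# ONE POINT — the class-of-record prime's mixed coordinate∘point certificate, via the depth-two KIT (brick S3 (c) «joint
# point∘coordinate chains», part 27, cell `res-dim4-pi`)

[OURS · counted 0] (D-0157 DOOR 2; desk WORD #66 (4)(c), #74 (g), #99 (d); frame `PIDim4.TerminationImpliesOrderReduction`,
S3 (c); host item stmt-ResolutionOfSingularities-16155, helper). Nothing here proves resolution of singularities in
dimension ≥ 4 / characteristic `p` — NOT here, not anywhere in this programme.

`F = x₁²·Q`, `Q = x₁x₂ + x₃x₄` (typ-3 g2's quadric, part TY-3k «QUADRIC»), `K = K̄` of characteristic `2`. The order-`2` points of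
`z² + F` form the 3-fold `{x₁ = 0}` (`∂F/∂x₂ = x₁³`); the `x₁`-chart transform is `Q`, whose only equimultiple point over the
exceptional hyperplane is the origin (typ-3 g2's `roots_quadric_subset`) — a LEAF with state `Q`, DEAD for the point centre (typ-3 g2's
`not_isEquimultiplePoint_quadric`). Part 25's KIT `exists_isMarkedResolution_depth_two_cert` then gives:

* **`exists_isMarkedResolution_inst₇`** — over `K = K̄` of characteristic `2`, `(𝔸⁵_K, (z² + x₁³x₂ + x₁²x₃x₄)·𝒪, [], 2)` admits a
  marked resolution (BGMW Def. 3.1.3). UNCONDITIONAL; the `p = 2` companion of part 24c, and the first certificate written on the kit.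

AI-produced formalisation, weaker than expert review. bears_on: LADDER-RESOLUTION:D157-DOOR2 (res-dim4-pi · S3 (c) joint v2 ·
leaf instance, p = 2).
-/

set_option linter.dupNamespace false -- D-0017: single-problem summit path `Summit.<S>.<S>.…` by design

noncomputable section

open MvPolynomial Finset CategoryTheory AlgebraicGeometry Opposite TopologicalSpace

namespace Summit.ResolutionOfSingularities.ResolutionOfSingularities.Theorems.PIDim4

open Literature.AlgebraicGeometry.Resolution
open Literature.AlgebraicGeometry.Resolution.Hauser2010
open Literature.AlgebraicGeometry.Resolution.AffinePointBlowup (P A γ coord Wtop ξ)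

namespace Equimultiple

section Instance₇

variable {K : Type} [Field K]

/-! ## §1 Computations for `F = x₁²(x₁x₂ + x₃x₄)` -/

/-- `F` as a sum of two monomials. [folklore] -/
theorem inst₇_eq_monomial_add :
    (X 0 ^ 2 * (X 0 * X 1 + X 2 * X 3) : MvPolynomial (Fin 4) K) =
      monomial (Finsupp.single 0 2 + (Finsupp.single 0 1 + Finsupp.single 1 1)) 1 +
        monomial (Finsupp.single 0 2 + (Finsupp.single 2 1 + Finsupp.single 3 1)) 1 := by
  rw [X_mul_X_eq_monomial, X_mul_X_eq_monomial, X_pow_eq_monomial, mul_add, monomial_mul, monomial_mul, mul_one]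

/-- The support of `F` lies in its two exponents. [folklore] -/
theorem mem_support_inst₇ {d : Fin 4 →₀ ℕ}
    (hd : d ∈ (X 0 ^ 2 * (X 0 * X 1 + X 2 * X 3) : MvPolynomial (Fin 4) K).support) :
    d = Finsupp.single 0 2 + (Finsupp.single 0 1 + Finsupp.single 1 1) ∨
      d = Finsupp.single 0 2 + (Finsupp.single 2 1 + Finsupp.single 3 1) := by
  rw [inst₇_eq_monomial_add] at hd
  rcases Finset.mem_union.mp (Finset.mem_of_subset MvPolynomial.support_add hd) with hd' | hd'
  · exact Or.inl (Finset.mem_singleton.mp (Finset.mem_of_subset support_monomial_subset hd'))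
  · exact Or.inr (Finset.mem_singleton.mp (Finset.mem_of_subset support_monomial_subset hd'))

/-- `F ≠ 0`. [folklore] -/
theorem inst₇_ne_zero : (X 0 ^ 2 * (X 0 * X 1 + X 2 * X 3) : MvPolynomial (Fin 4) K) ≠ 0 := by
  intro h
  have hne : (Finsupp.single (0 : Fin 4) 2 + (Finsupp.single 2 1 + Finsupp.single 3 1)) ≠
      Finsupp.single 0 2 + (Finsupp.single 0 1 + Finsupp.single 1 1) := fun h' => by
    have := DFunLike.congr_fun h' 1; simp at this
  have hc := congrArg (coeff (Finsupp.single (0 : Fin 4) 2 + (Finsupp.single 0 1 + Finsupp.single 1 1))) h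
  rw [inst₇_eq_monomial_add, coeff_add, coeff_monomial, if_pos rfl, coeff_monomial, if_neg hne, coeff_zero, add_zero] at hc
  exact one_ne_zero hc

/-- `F` is clean for `p = 2` (both monomials have an odd exponent `1`). [cite: HauserPerlega2019PRIMS, §2 (cleaning)] -/
theorem isClean_inst₇ :
    Literature.Barriers.ResolutionOfSingularities.HauserPerlega.IsClean 2 (X 0 ^ 2 * (X 0 * X 1 + X 2 * X 3) : MvPolynomial (Fin 4) K) := by
  intro d hd hpth
  rcases mem_support_inst₇ hd with rfl | rfl
  · have h0 : (Finsupp.single 0 2 + (Finsupp.single 0 1 + Finsupp.single 1 1) : Fin 4 →₀ ℕ) 1 = 1 := by simp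
    have h := hpth 1 (by rw [Finsupp.mem_support_iff, h0]; exact one_ne_zero)
    rw [h0] at h
    exact absurd (Nat.dvd_one.mp h) (by decide)
  · have h0 : (Finsupp.single 0 2 + (Finsupp.single 2 1 + Finsupp.single 3 1) : Fin 4 →₀ ℕ) 2 = 1 := by simp
    have h := hpth 2 (by rw [Finsupp.mem_support_iff, h0]; exact one_ne_zero)
    rw [h0] at h
    exact absurd (Nat.dvd_one.mp h) (by decide)

/-- **`V(z, x₁)` is Hironaka-permissible for `z² + F`.** [cite: HauserPerlega2019PRIMS, §2 (condition (1))] -/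
theorem isPermissibleCentre_inst₇ :
    IsPermissibleCentre 2 ({0} : Finset (Fin 4)) (X 0 ^ 2 * (X 0 * X 1 + X 2 * X 3) : MvPolynomial (Fin 4) K) := by
  refine ⟨⟨0, Finset.mem_singleton_self _⟩, Finset.le_inf fun d hd => ?_⟩
  rcases mem_support_inst₇ hd with rfl | rfl <;> simp [degIn_singleton_zero]
  exact_mod_cast (by norm_num : (2 : ℕ) ≤ 3)

/-- **The `x₁`-chart transform of `F` is the quadric `x₁x₂ + x₃x₄`.** [cite: HauserPerlega2019PRIMS, §2 (the x₁-chart)] -/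
theorem chartTransform_inst₇ :
    CentreBlowup.chartTransform 2 ({0} : Finset (Fin 4)) 0 (X 0 ^ 2 * (X 0 * X 1 + X 2 * X 3) : MvPolynomial (Fin 4) K) =
      X 0 * X 1 + X 2 * X 3 := by
  rw [inst₇_eq_monomial_add, CentreBlowup.chartTransform_monomial_add_monomial, CentreBlowup.chartExponent,
    CentreBlowup.chartExponent, degIn_singleton_zero, degIn_singleton_zero]
  have e1 : (Finsupp.single 0 2 + (Finsupp.single 0 1 + Finsupp.single 1 1) : Fin 4 →₀ ℕ).update 0
      ((Finsupp.single 0 2 + (Finsupp.single 0 1 + Finsupp.single 1 1) : Fin 4 →₀ ℕ) 0 - 2) =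
        Finsupp.single 0 1 + Finsupp.single 1 1 := by
    ext i; fin_cases i <;> simp [Finsupp.update_apply]
  have e2 : (Finsupp.single 0 2 + (Finsupp.single 2 1 + Finsupp.single 3 1) : Fin 4 →₀ ℕ).update 0
      ((Finsupp.single 0 2 + (Finsupp.single 2 1 + Finsupp.single 3 1) : Fin 4 →₀ ℕ) 0 - 2) =
        Finsupp.single 2 1 + Finsupp.single 3 1 := by
    ext i; fin_cases i <;> simp [Finsupp.update_apply]
  rw [e1, e2, ← X_mul_X_eq_monomial, ← X_mul_X_eq_monomial]

/-- **The root parameters lie on the member**: order `2` at `(a, b)` forces `b₁ = 0` (`∂F/∂x₂ = x₁³`).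
[cite: Hauser2010, §F (equiconstant points)] -/
theorem roots_inst₇ [CharP K 2] (b : Fin 4 → K)
    (H : ∀ d : Fin 4 →₀ ℕ, d ≠ 0 → d.degree < 2 →
      coeff d (PointBlowup.translate b (X 0 ^ 2 * (X 0 * X 1 + X 2 * X 3) : MvPolynomial (Fin 4) K)) = 0) :
    b 0 = 0 := by
  haveI : Fact (Nat.Prime 2) := ⟨Nat.prime_two⟩
  have h1 := eval_pderiv_eq_zero_of_forall_coeff (p := 2) b _ H 1
  simp [(pderiv (1 : Fin 4)).leibniz_pow] at h1
  exact h1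

/-- **The `F`-component of the leaf state** `step 2 {x₁} x₁ 0 (F, 0, ∅)` is the quadric. [cite: Hauser2010, §§F–G] -/
theorem step_F_inst₇ [DecidableEq K] :
    (CentreBlowup.step 2 ({0} : Finset (Fin 4)) 0 0 (⟨X 0 ^ 2 * (X 0 * X 1 + X 2 * X 3), 0, ∅⟩ : State K)).F =
      X 0 * X 1 + X 2 * X 3 := by
  show deletePthPowers 2 (PointBlowup.translate 0 (CentreBlowup.chartTransform 2 ({0} : Finset (Fin 4)) 0
    (X 0 ^ 2 * (X 0 * X 1 + X 2 * X 3) : MvPolynomial (Fin 4) K))) = _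
  rw [chartTransform_inst₇, PointBlowup.translate_zero]
  exact Literature.Barriers.ResolutionOfSingularities.HauserPerlega.deletePthPowers_eq_self isClean_quadric

/-- **The only equimultiple point of the `x₁`-chart is the origin** (typ-3 g2's `roots_quadric_subset`).
[cite: Hauser2010, §F (equiconstant points)] -/
theorem eq_zero_of_isEquimultiplePoint_inst₇ [DecidableEq K] {b : Fin 4 → K}
    (h : CentreBlowup.IsEquimultiplePoint 2 ({0} : Finset (Fin 4)) 0 b
      (⟨X 0 ^ 2 * (X 0 * X 1 + X 2 * X 3), 0, ∅⟩ : State K)) : b = 0 := by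
  unfold CentreBlowup.IsEquimultiplePoint CentreBlowup.pointTransform at h
  rw [show (⟨X 0 ^ 2 * (X 0 * X 1 + X 2 * X 3), 0, ∅⟩ : State K).F = X 0 ^ 2 * (X 0 * X 1 + X 2 * X 3) from rfl,
    chartTransform_inst₇] at h
  exact roots_quadric_subset b h

/-! ## §2 The certificate (via the kit) -/

/-- **`z² + x₁³x₂ + x₁²x₃x₄` ADMITS A MARKED RESOLUTION BY A 3-FOLD BLOW-UP FOLLOWED BY A POINT BLOW-UP** (`K = K̄` of
characteristic `2`): part 25's kit with the member `(0, {x₁})`, no entry and the one leaf `(x₁, 0)`, whose state — the quadric — is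
dead for the point centre. [cite: BierstoneGrigorievMilmanWlodarczyk2011, Def. 3.1.3] [cite: HauserPerlega2019PRIMS, §2] [cite: Hauser2010, §F] -/
theorem exists_isMarkedResolution_inst₇ [IsAlgClosed K] [CharP K 2] [DecidableEq K] :
    ∃ (X' : Scheme.{0}) (ρ : X' ⟶ P 4 K) (M' : MarkedIdeal X'),
      IsMarkedResolution (⟨hypSheaf 2 (X 0 ^ 2 * (X 0 * X 1 + X 2 * X 3) : MvPolynomial (Fin 4) K), [], 2⟩ :
        MarkedIdeal (P 4 K)) ρ M' := by
  classical
  haveI : Fact (Nat.Prime 2) := ⟨Nat.prime_two⟩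
  have hG₀ : deletePthPowers 2 (PointBlowup.translate (0 : Fin 4 → K) (X 0 ^ 2 * (X 0 * X 1 + X 2 * X 3) : MvPolynomial (Fin 4) K)) =
      X 0 ^ 2 * (X 0 * X 1 + X 2 * X 3) := by
    rw [PointBlowup.translate_zero]
    exact Literature.Barriers.ResolutionOfSingularities.HauserPerlega.deletePthPowers_eq_self isClean_inst₇
  refine exists_isMarkedResolution_depth_two_cert (p := 2) (X 0 ^ 2 * (X 0 * X 1 + X 2 * X 3)) inst₇_ne_zero isClean_inst₇
    (0 : Fin 4 → K) ({0} : Finset (Fin 4)) ⟨X 0 ^ 2 * (X 0 * X 1 + X 2 * X 3), 0, ∅⟩ (by rw [hG₀]) isPermissibleCentre_inst₇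
    (fun b' H i hi => ?_) ∅ {((0 : Fin 4), (0 : Fin 4 → K))} (fun e he => absurd he (Finset.notMem_empty e))
    (fun e he => absurd he (Finset.notMem_empty e)) (fun j' b' hj' _ _ heq => ?_)
    (fun e he => absurd he (Finset.notMem_empty e)) (fun l hl k c _ => ?_)
  · -- root parameters on the member
    rw [Finset.mem_singleton] at hi
    subst hi
    exact roots_inst₇ b' H
  · -- cover: the only equimultiple pair is the leaf
    rw [Finset.mem_singleton] at hj'
    subst hj'
    right
    rw [eq_zero_of_isEquimultiplePoint_inst₇ heq]
    exact Finset.mem_singleton_self _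
  · -- the leaf is dead
    rw [Finset.mem_singleton] at hl
    subst hl
    exact not_isEquimultiplePoint_quadric k c _ step_F_inst₇

end Instance₇

end Equimultiple

end Summit.ResolutionOfSingularities.ResolutionOfSingularities.Theorems.PIDim4

end
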